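import Summits.BirchSwinnertonDyer.BirchSwinnertonDyer.Theorems.Rank2Observatory2DescClCurveCertSMain
import HarnessLib

/-!
# BirchSwinnertonDyer — rank ≥ 2 observatory: KERNEL-2DESC-CL v3.0, S4 — the SPLIT-2 per-curve certificate (complex case), part 4/4: `K`-free row shapes

HONEST FRAMING: per-curve certified theorems and census instruments; no claim on BSD in rank ≥ 2.

Part 4 of 4 (mechanism in part 1, `…ClCurveCertSDefs`).  This part: the `K`-free row shapes the per-curve files
instantiate — `rank_eq_of_certsS` (model `(0, A, 0, B, C)` over the abstract cubic field of the base view),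
`rank_eq_of_certsS_scaled` / `_complSq` (original model via the rescaled completed square) and `_plain`.
Text = the v2.3 shapes (`…ClCurveCertE2`) with the split-2 records.  New declarations only.
Sorry-free; axioms `propext`, `Classical.choice`, `Quot.sound`.
[cite: CremonaAlgorithms1997, §3.6] [cite: SilvermanAEC2009, III.3.1(b)] [cite: Cassels1991LecturesEllipticCurves, §15]
-/

set_option linter.dupNamespace false

noncomputable section

open scoped Classical NumberField nonZeroDivisors

open Literature.NumberTheory.NumberFields Polynomial Module NumberField IsDedekindDomain Ideal

namespace Summit.BirchSwinnertonDyer.BirchSwinnertonDyer.Rank2Observatory.TwoDescCl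

open TwoDescCubic ClFieldCert

/-! ## `K`-free row shapes -/

section Rows

/-- **Row shape**: `rank E(ℚ) = r` from the two records, two kernel `decide`s, the primality list and the lower
bound — over the abstract cubic field of the base view. [cite: CremonaAlgorithms1997, §3.6] -/
theorem rank_eq_of_certsS (r : ℕ) (F : ClFieldCertS2) (cc : ClCurveCertS) (h2 : F.check2 = true)
    (hpr : F.fs.base.primeList.Forall Nat.Prime) (hc : checkS F cc r = true)
    (hlow : r ≤ (((⟨0, cc.A, 0, cc.B, cc.C⟩ : WeierstrassCurve ℤ)).map (Int.castRingHom ℚ)).mordellWeilRank) :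
    (((⟨0, cc.A, 0, cc.B, cc.C⟩ : WeierstrassCurve ℤ)).map (Int.castRingHom ℚ)).mordellWeilRank = r := by
  haveI : Fact (Irreducible (MonicCubic.polyQ F.fs.base.a F.fs.base.b F.fs.base.c)) :=
    ⟨F.fs.base.irreducible_of_field (F.field_of_check2 h2)⟩
  exact rank_eq_of_checkS r F (K := CubicField F.fs.base.a F.fs.base.b F.fs.base.c)
    (CubicField.aeval_root F.fs.base.a F.fs.base.b F.fs.base.c) (CubicField.finrank_eq F.fs.base.a F.fs.base.b
      F.fs.base.c) h2 hpr cc hc hlow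

/-- **`rank E(ℚ) = r` for the ORIGINAL model** `(a₁, a₂, a₃, a₄, a₆)` when the records certify its
completed-square model RESCALED by `d` — `(0, d²(a₁² + 4a₂), 0, 8d⁴(a₁a₃ + 2a₄), 16d⁶(a₃² + 4a₆))` — (rank is
invariant under both variable changes; `d = 1` is the plain completed square). [cite: CremonaAlgorithms1997, §3.6]
[cite: SilvermanAEC2009, III.3.1(b)] -/
theorem rank_eq_of_certsS_scaled (r : ℕ) (F : ClFieldCertS2) (cc : ClCurveCertS) (h2 : F.check2 = true)
    (hpr : F.fs.base.primeList.Forall Nat.Prime) (hc : checkS F cc r = true) (a₁ a₂ a₃ a₄ a₆ d : ℤ)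
    (hd : d ≠ 0)
    (hABC : cc.A = d ^ 2 * (a₁ ^ 2 + 4 * a₂) ∧ cc.B = d ^ 4 * (8 * (a₁ * a₃ + 2 * a₄)) ∧
      cc.C = d ^ 6 * (16 * (a₃ ^ 2 + 4 * a₆)))
    (hlow : r ≤ (((⟨a₁, a₂, a₃, a₄, a₆⟩ : WeierstrassCurve ℤ)).map (Int.castRingHom ℚ)).mordellWeilRank) :
    (((⟨a₁, a₂, a₃, a₄, a₆⟩ : WeierstrassCurve ℤ)).map (Int.castRingHom ℚ)).mordellWeilRank = r := by
  obtain ⟨hA, hB, hC⟩ := hABC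
  -- completed square
  have hV : ((⟨0, a₁ ^ 2 + 4 * a₂, 0, 8 * (a₁ * a₃ + 2 * a₄), 16 * (a₃ ^ 2 + 4 * a₆)⟩ : WeierstrassCurve ℤ)).map
        (Int.castRingHom ℚ) =
      (⟨Units.mk0 (1 / 2 : ℚ) (by norm_num), 0, -(a₁ : ℚ) / 2, -(a₃ : ℚ) / 2⟩ :
        WeierstrassCurve.VariableChange ℚ) •
        (((⟨a₁, a₂, a₃, a₄, a₆⟩ : WeierstrassCurve ℤ)).map (Int.castRingHom ℚ)) := by
    ext <;> simp only [WeierstrassCurve.map_a₁, WeierstrassCurve.map_a₂, WeierstrassCurve.map_a₃,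
      WeierstrassCurve.map_a₄, WeierstrassCurve.map_a₆, WeierstrassCurve.variableChange_a₁,
      WeierstrassCurve.variableChange_a₂, WeierstrassCurve.variableChange_a₃,
      WeierstrassCurve.variableChange_a₄, WeierstrassCurve.variableChange_a₆, Units.val_inv_eq_inv_val,
      Units.val_mk0, eq_intCast, Int.cast_zero] <;> push_cast <;> ring
  have hr₁ : (((⟨0, a₁ ^ 2 + 4 * a₂, 0, 8 * (a₁ * a₃ + 2 * a₄), 16 * (a₃ ^ 2 + 4 * a₆)⟩ : WeierstrassCurve ℤ)).map
        (Int.castRingHom ℚ)).mordellWeilRank =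
      (((⟨a₁, a₂, a₃, a₄, a₆⟩ : WeierstrassCurve ℤ)).map (Int.castRingHom ℚ)).mordellWeilRank := by
    rw [hV]; exact WeierstrassCurve.mordellWeilRank_variableChange_holds _ _
  -- rescaling
  have hS : scaleModel (⟨0, a₁ ^ 2 + 4 * a₂, 0, 8 * (a₁ * a₃ + 2 * a₄), 16 * (a₃ ^ 2 + 4 * a₆)⟩ :
      WeierstrassCurve ℤ) d = ⟨0, cc.A, 0, cc.B, cc.C⟩ := by
    simp only [scaleModel, hA, hB, hC, mul_zero]
  have hr₂ := mordellWeilRank_scaleModel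
    (⟨0, a₁ ^ 2 + 4 * a₂, 0, 8 * (a₁ * a₃ + 2 * a₄), 16 * (a₃ ^ 2 + 4 * a₆)⟩ : WeierstrassCurve ℤ) hd
  rw [hS] at hr₂
  rw [← hr₁, ← hr₂] at hlow ⊢
  exact rank_eq_of_certsS r F cc h2 hpr hc hlow

/-- The plain completed-square shape (`d = 1`). [cite: CremonaAlgorithms1997, §3.6] -/
theorem rank_eq_of_certsS_complSq (r : ℕ) (F : ClFieldCertS2) (cc : ClCurveCertS) (h2 : F.check2 = true)
    (hpr : F.fs.base.primeList.Forall Nat.Prime) (hc : checkS F cc r = true) (a₁ a₂ a₃ a₄ a₆ : ℤ)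
    (hABC : cc.A = a₁ ^ 2 + 4 * a₂ ∧ cc.B = 8 * (a₁ * a₃ + 2 * a₄) ∧ cc.C = 16 * (a₃ ^ 2 + 4 * a₆))
    (hlow : r ≤ (((⟨a₁, a₂, a₃, a₄, a₆⟩ : WeierstrassCurve ℤ)).map (Int.castRingHom ℚ)).mordellWeilRank) :
    (((⟨a₁, a₂, a₃, a₄, a₆⟩ : WeierstrassCurve ℤ)).map (Int.castRingHom ℚ)).mordellWeilRank = r :=
  rank_eq_of_certsS_scaled r F cc h2 hpr hc a₁ a₂ a₃ a₄ a₆ 1 one_ne_zero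
    (by obtain ⟨hA, hB, hC⟩ := hABC; exact ⟨by rw [hA]; ring, by rw [hB]; ring, by rw [hC]; ring⟩) hlow

/-- Row plumbing for a curve already given by a plain model `y² = x³ + a₂x² + a₄x + a₆` (`a₁ = a₃ = 0`): the record's
cubic IS the curve. [cite: Cassels1991LecturesEllipticCurves, §15] -/
theorem rank_eq_of_certsS_plain (r : ℕ) (F : ClFieldCertS2) (cc : ClCurveCertS) (h2 : F.check2 = true)
    (hpr : F.fs.base.primeList.Forall Nat.Prime) (hc : checkS F cc r = true) (a₂ a₄ a₆ : ℤ)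
    (hABC : cc.A = a₂ ∧ cc.B = a₄ ∧ cc.C = a₆)
    (hlow : r ≤ (((⟨0, a₂, 0, a₄, a₆⟩ : WeierstrassCurve ℤ)).map (Int.castRingHom ℚ)).mordellWeilRank) :
    (((⟨0, a₂, 0, a₄, a₆⟩ : WeierstrassCurve ℤ)).map (Int.castRingHom ℚ)).mordellWeilRank = r := by
  obtain ⟨rfl, rfl, rfl⟩ := hABC
  exact rank_eq_of_certsS r F cc h2 hpr hc hlow

end Rows

end Summit.BirchSwinnertonDyer.BirchSwinnertonDyer.Rank2Observatory.TwoDescCl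

end
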